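import Summits.CriticalPhenomena.PercolationContinuityZ3.Theorems.PercNearOneGluingNoHeavyLowerTailKNGoodGMgcCertFast
import HarnessLib

/-!
# THEOREM B certificates — the trilinear condition (B1b), branch `Φ_δ / Q₂₃` (branch `d`), designee position `j = 1` (core-bottom), all `r`
# (`NoHeavyLowerTail` cell, stmt-CriticalPhenomena-4575; prover `prim-hp-2`, gen 17)

Support file (`--supports stmt-CriticalPhenomena-4575`, COMPUTATIONAL: three `native_decide` evaluations of the packed check
`KNGoodGMgc.fastTri 1 r false`, ≈ 25 s each: Kronecker-packed big-integer products, `…SBTensKron`).  No definitions, no named facts, no sorries.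
(B1b) of memo MEMO-gen15 §3d, multiplied out (`X·v·w + Y·u·w ≤ G·u·v`, factor table `KNGoodGMgc.facX … facW`): all 4¹² scaled-Bernstein
coefficients of the slack are `≥ 0` (`checkTri`, via `checkTri_of_fastTri`), hence the inequality on `[0,1]¹²` (`tri_of_check`).  The same integers
were computed off-line by three independent implementations (seat gen 15 `trilin3.py` 64 (k,n₁,n₂)-groups per condition; ttrl `hp2b/THMB-BERNSTEIN.md`;
kit job j105771 `cert12` in this single-tensor form: min coefficient exactly `0`, ≈ 1.3–1.6·10⁶ of 4¹² nonzero).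
-/

namespace Summit.CriticalPhenomena.PercolationContinuityZ3.Theorems

namespace KNGoodGMgc

/-- (B1b)-d, `r = 1`: the scaled-Bernstein check passes (COMPUTATIONAL, packed `native_decide`). [this work] -/
theorem checkTri_1_1_D : checkTri 1 1 false = true := checkTri_of_fastTri 1 1 false (by native_decide)

/-- (B1b)-d, `r = 2`: the scaled-Bernstein check passes (COMPUTATIONAL, packed `native_decide`). [this work] -/
theorem checkTri_1_2_D : checkTri 1 2 false = true := checkTri_of_fastTri 1 2 false (by native_decide)

/-- (B1b)-d, `r = 3`: the scaled-Bernstein check passes (COMPUTATIONAL, packed `native_decide`). [this work] -/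
theorem checkTri_1_3_D : checkTri 1 3 false = true := checkTri_of_fastTri 1 3 false (by native_decide)

/-- **(B1b) of THEOREM B, branch `Φ_δ / Q₂₃` (branch `d`), every pocket reference `r ∈ {1,2,3}`**: `X·v·w + Y·u·w ≤ G·u·v` for all twelve
side parameters in `[0,1]` (memo MEMO-gen15 §3d/§3k). [this work] -/
theorem tri_1_D (r : ℕ) (hr : r = 1 ∨ r = 2 ∨ r = 3) (x : ℕ → ℝ) (hx : ∀ i, 0 ≤ x i ∧ x i ≤ 1) :
    bexp 11 (facX 1 r false) x * (bexp 12 (qHat (facV 1)) x * bexp 12 (qHat (facW 1 false)) x) +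
        bexp 11 (facY 1 r) x * (bexp 12 (qHat (facU 1 false)) x * bexp 12 (qHat (facW 1 false)) x) ≤
      bexp 11 (facG 1 r false) x * (bexp 12 (qHat (facU 1 false)) x * bexp 12 (qHat (facV 1)) x) := by
  rcases hr with rfl | rfl | rfl
  · exact tri_of_check 1 1 false checkTri_1_1_D x hx
  · exact tri_of_check 1 2 false checkTri_1_2_D x hx
  · exact tri_of_check 1 3 false checkTri_1_3_D x hx

end KNGoodGMgc

end Summit.CriticalPhenomena.PercolationContinuityZ3.Theorems
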